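import Summits.QuantumAdvantage.QuantumAdvantage.Theorems.MobiusLadderLiouvilleOrthogonalTC0SensLtf
import Summits.QuantumAdvantage.QuantumAdvantage.Theorems.MobiusLadderLiouvilleOrthogonalTC0Spectral
import Literature.Computability.Complexity.FourierDegree
import HarnessLib

/-!
# Crux `MobiusLadder.LiouvilleOrthogonalTC0` (stmt-QuantumAdvantage-1393): the PTF rung glue —
`λ` is orthogonal to every polynomial threshold function of bounded degree in the binary digits,
given the Diakonikolas–Raghavendra–Servedio–Tan block-sensitivity bound

Line `Sketch`, skeleton v10 (lead `prover-line-stmt-QuantumAdvantage-1393-c6-0`), registered stub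
`stub_ptfRung`. Hypothesis `hBS` (the neighbouring stub `stub_ptfBlock`): for every real `p` on the cube
`Fin n → Bool` of Fourier degree `≤ d` and every `m`-partition `π` of the variables, the number of pairs
(point `x`, block `j`) with `[0 ≤ p x] ≠ [0 ≤ p (x ⊕ π⁻¹ j)]` is `≤ 2 m^{1−1/2^d} 2ⁿ`. Conclusion: for
every `ε > 0`, eventually in `n`, every (possibly negated) polynomial threshold function
`x ↦ b ⊕ [0 ≤ p x]` with `fourierDegree p ≤ d` has `|Σ_{N<2ⁿ} λ(N) sgn(b ⊕ [0 ≤ p(bits N)])| ≤ ε 2ⁿ`.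

Proof (the shape of the bounded-size rung `…TC0SizeRung.lean`): negating by `b` does not change the
pivotal blocks (`xor b u ≠ xor b v ↔ u ≠ v`), so `hBS` is the hypothesis of Peres' conclusion
`stub_tailOfSens` with `B = 2 m^{1−1/2^d}/√m`, giving the Fourier tail
`W^{≥ m} ≤ 3B/√m = 6 m^{1−1/2^d}/m = 6 m^{−1/2^d}` for `m ≥ 10`; for `1 ≤ m ≤ 9` the tail is `≤ 1 ≤ 3/√m`.
Hence `W^{≥ m} ≤ τ(m) := 6 m^{−1/2^d} + 3/√m → 0` for all `m ≥ 1`, uniformly in `n`, `p`, `b`, and the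
spectral criterion `stub_spectral` finishes.

* `StubPtfRung.tau_tendsto`, `StubPtfRung.tailWeight_ptf_le` — the rate `τ → 0` and the uniform tail
  bound;
* `stub_ptfRung` — the registered stub, verbatim.
-/

set_option linter.dupNamespace false -- D-0017: single-problem summit ⇒ `QuantumAdvantage.QuantumAdvantage` by design

noncomputable section

namespace Summit.QuantumAdvantage.QuantumAdvantage.Theorems.LiouvilleOrthogonalTC0

open Filter Finset Topology
open Literature.Computability.Complexity
open Literature.Computability.Complexity.LowDegree (tailWeight tailWeight_le_one)
open Literature.Probability.RandomGraphs.LowDegree (sgn)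

namespace StubPtfRung

/-- The tail rate of the PTF rung, `τ_d(m) = 6 m^{−1/2^d} + 3/√m`, tends to `0` as `m → ∞`. -/
theorem tau_tendsto (d : ℕ) :
    Tendsto (fun m : ℕ => 6 * (m : ℝ) ^ (-(1 / (2 : ℝ) ^ d)) + 3 / Real.sqrt m) atTop (𝓝 0) := by
  have h1 : Tendsto (fun m : ℕ => (m : ℝ) ^ (-(1 / (2 : ℝ) ^ d))) atTop (𝓝 0) :=
    (tendsto_rpow_neg_atTop (by positivity)).comp tendsto_natCast_atTop_atTop
  have h2 : Tendsto (fun m : ℕ => 3 / Real.sqrt m) atTop (𝓝 0) :=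
    tendsto_const_nhds.div_atTop (Real.tendsto_sqrt_atTop.comp tendsto_natCast_atTop_atTop)
  simpa using (h1.const_mul 6).add h2

/-- For `1 ≤ m ≤ 9`, `1 ≤ 3/√m ≤ τ_d(m)`. -/
theorem one_le_tau (d : ℕ) {m : ℕ} (hm : 1 ≤ m) (hm9 : m ≤ 9) :
    (1 : ℝ) ≤ 6 * (m : ℝ) ^ (-(1 / (2 : ℝ) ^ d)) + 3 / Real.sqrt m := by
  have hmpos : (0 : ℝ) < m := Nat.cast_pos.2 (by omega)
  have hs0 : 0 < Real.sqrt m := Real.sqrt_pos.2 hmpos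
  have h3 : (1 : ℝ) ≤ 3 / Real.sqrt m := by
    rw [le_div_iff₀ hs0, one_mul]
    calc Real.sqrt m ≤ Real.sqrt ((3 : ℝ) ^ 2) :=
          Real.sqrt_le_sqrt (by norm_num; exact_mod_cast hm9)
      _ = 3 := Real.sqrt_sq (by norm_num)
  have h6 : (0 : ℝ) ≤ 6 * (m : ℝ) ^ (-(1 / (2 : ℝ) ^ d)) := by positivity
  linarith

/-- Negating a Boolean function does not change which blocks are pivotal. -/
theorem xor_ne_xor_iff (b u v : Bool) : (xor b u ≠ xor b v) ↔ (u ≠ v) :=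
  Bool.xor_right_inj.not

/-- **Uniform Fourier tail of bounded-degree polynomial threshold functions** (given the block
sensitivity bound `hBS`): `W^{≥ m}[sgn (b ⊕ [0 ≤ p ·])] ≤ τ_d(m)` for `fourierDegree p ≤ d`, `m ≥ 1`,
uniformly in the number of variables. -/
theorem tailWeight_ptf_le
    (hBS : ∀ (n m d : ℕ) (p : (Fin n → Bool) → ℝ), fourierDegree p ≤ d → ∀ π : Fin n → Fin m,
      ∑ x : Fin n → Bool, ((Finset.univ.filter fun j : Fin m =>
          decide (0 ≤ p x) ≠ decide (0 ≤ p (fun i => xor (x i) (decide (π i = j))))).card : ℝ)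
        ≤ 2 * (m : ℝ) ^ ((1 : ℝ) - 1 / 2 ^ d) * (2 : ℝ) ^ n)
    {n d : ℕ} (p : (Fin n → Bool) → ℝ) (hp : fourierDegree p ≤ d) (b : Bool) {m : ℕ} (hm : 1 ≤ m) :
    tailWeight (fun x : Fin n → Bool => sgn (xor b (decide (0 ≤ p x)))) m
      ≤ 6 * (m : ℝ) ^ (-(1 / (2 : ℝ) ^ d)) + 3 / Real.sqrt m := by
  have hmpos : (0 : ℝ) < m := Nat.cast_pos.2 (by omega)
  have hs0 : 0 < Real.sqrt m := Real.sqrt_pos.2 hmpos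
  by_cases hm9 : m ≤ 9
  · -- small `m`: `W^{≥m} ≤ 1 ≤ 3/√m ≤ τ_d(m)`
    have h1 : tailWeight (fun x : Fin n → Bool => sgn (xor b (decide (0 ≤ p x)))) m ≤ 1 :=
      tailWeight_le_one (fun x => by cases xor b (decide (0 ≤ p x)) <;> simp) m
    exact h1.trans (one_le_tau d hm hm9)
  · have hm10 : 10 ≤ m := by omega
    have hs0' : Real.sqrt m ≠ 0 := hs0.ne'
    set A : ℝ := (m : ℝ) ^ ((1 : ℝ) - 1 / 2 ^ d) with hA
    -- the block counts of `b ⊕ [0 ≤ p ·]` are those of `[0 ≤ p ·]`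
    have hδ : ∀ π : Fin n → Fin m, ∑ x : Fin n → Bool,
        ((univ.filter fun j : Fin m => xor b (decide (0 ≤ p x)) ≠
          xor b (decide (0 ≤ p (fun i => xor (x i) (decide (π i = j)))))).card : ℝ)
          ≤ 2 * A / Real.sqrt m * (2 ^ n * Real.sqrt m) := by
      intro π
      have hcount := hBS n m d p hp π
      simp only [xor_ne_xor_iff]
      calc _ ≤ 2 * A * (2 : ℝ) ^ n := hcount
        _ = 2 * A / Real.sqrt m * (2 ^ n * Real.sqrt m) := by
            field_simp
    have h := stub_tailOfSens hm10 (B := 2 * A / Real.sqrt m)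
      (fun x : Fin n → Bool => xor b (decide (0 ≤ p x))) hδ
    -- `3B/√m = 6 m^{1-1/2^d}/m = 6 m^{-1/2^d}`
    have hAm : A / m = (m : ℝ) ^ (-(1 / (2 : ℝ) ^ d)) := by
      rw [hA, ← Real.rpow_sub_one hmpos.ne']
      congr 1
      ring
    have hkey : 3 * (2 * A / Real.sqrt m) / Real.sqrt m = 6 * (m : ℝ) ^ (-(1 / (2 : ℝ) ^ d)) := by
      calc 3 * (2 * A / Real.sqrt m) / Real.sqrt m = 6 * (A / (Real.sqrt m * Real.sqrt m)) := by ring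
        _ = 6 * (m : ℝ) ^ (-(1 / (2 : ℝ) ^ d)) := by rw [Real.mul_self_sqrt hmpos.le, hAm]
    have h3 : (0 : ℝ) ≤ 3 / Real.sqrt m := by positivity
    calc tailWeight (fun x : Fin n → Bool => sgn (xor b (decide (0 ≤ p x)))) m
        ≤ 3 * (2 * A / Real.sqrt m) / Real.sqrt m := h
      _ = 6 * (m : ℝ) ^ (-(1 / (2 : ℝ) ^ d)) := hkey
      _ ≤ 6 * (m : ℝ) ^ (-(1 / (2 : ℝ) ^ d)) + 3 / Real.sqrt m := le_add_of_nonneg_right h3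

end StubPtfRung

/-- **Registered stub `stub_ptfRung` (P3, v10): the PTF rung glue.** Given the block-sensitivity bound
`hBS` for polynomial threshold functions of Fourier degree `≤ d` (`stub_ptfBlock`), for every `ε > 0`,
eventually in `n`, every `p` with `fourierDegree p ≤ d` and every `b` satisfy
`|Σ_{N<2ⁿ} λ(N) sgn(b ⊕ [0 ≤ p(bits N)])| ≤ ε 2ⁿ` — `stub_tailOfSens` with `B = 2 m^{1/2−1/2^d}` and the
uniform spectral criterion `stub_spectral` with `τ(m) = 6 m^{−1/2^d} + 3/√m`. -/
theorem stub_ptfRung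
    (hBS : ∀ (n m d : ℕ) (p : (Fin n → Bool) → ℝ), fourierDegree p ≤ d → ∀ π : Fin n → Fin m,
      ∑ x : Fin n → Bool, ((Finset.univ.filter fun j : Fin m =>
          decide (0 ≤ p x) ≠ decide (0 ≤ p (fun i => xor (x i) (decide (π i = j))))).card : ℝ)
        ≤ 2 * (m : ℝ) ^ ((1 : ℝ) - 1 / 2 ^ d) * (2 : ℝ) ^ n)
    (d : ℕ) : ∀ ε : ℝ, 0 < ε → ∀ᶠ n : ℕ in atTop, ∀ (p : (Fin n → Bool) → ℝ), fourierDegree p ≤ d →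
      ∀ b : Bool, |∑ N ∈ Finset.range (2 ^ n), ((ArithmeticFunction.liouville N : ℤ) : ℝ) *
          sgn (xor b (decide (0 ≤ p (fun i : Fin n => Nat.testBit N i))))| ≤ ε * (2 : ℝ) ^ n := by
  intro ε hε
  filter_upwards [stub_spectral (fun m : ℕ => 6 * (m : ℝ) ^ (-(1 / (2 : ℝ) ^ d)) + 3 / Real.sqrt m)
    (StubPtfRung.tau_tendsto d) ε hε] with n hn p hp b
  exact hn (fun x : Fin n → Bool => xor b (decide (0 ≤ p x)))
    (fun m hm => StubPtfRung.tailWeight_ptf_le hBS p hp b hm)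

end Summit.QuantumAdvantage.QuantumAdvantage.Theorems.LiouvilleOrthogonalTC0
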